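import Summits.QuantumFields.YangMills.Theorems.BalabanUVNodesN15KingModelGraphKatoDomination
import Summits.QuantumFields.YangMills.Theorems.BalabanUVNodesN15KingModelBoxReflectionPositivity
import Summits.QuantumFields.YangMills.Theorems.BalabanUVNodesN15KingModelCovariantDecay
import HarnessLib

/-!
# BalabanUVNodes ∕ N15 — THE KING-MODEL RUNG (PART Ͱ-n): THE BOX TWIN AT A LIVE LINK FIELD — the covariant fine operator on King's region `Ω` with FREE boundary conditions is the
# coupling of a box hopping datum whose scalar shadow IS `boxOp n c m²`; hence `‖((−cΔ^{Ω}_U+m²)⁻¹)_{st}‖ ≤ G^{Ω}(s,t) = kingBoxGreen n c m² s t` at EVERY unitary `U`, with PART Ν∕Ε's box decay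
# (Track A, DAG node N15 = NE2; FAN-OUT v1.1 §N15 s3 «KING-MODEL RUNG … torus-vs-box twin»; count-neutral)

HONEST FRAMING.  Count-neutral (cell `pub-ymgap`, seat `pub-ymgap-dag-n15-e` g42; `--supports stmt-QuantumFields-27247 --as helper` = K3ᴬ, KEY MAP v3).  King's `A = 0` box covariance
`G^{Ω} = (boxOp n c m²)⁻¹` (PARTS Ν∕Ε∕Ϟ) is the comparison object; the fine covariant Neumann operator only; NOT Bałaban's `G_k(U)` on `Λ` (block penalty, Ͱ-j); NOT a node discharge
(N15 of record untouched); nothing continuum ∕ ℝ⁴ ∕ OS ∕ Clay.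

THE RESULT.  On King's region `Ω = Π_μ{0,…,n_μ−1}` ([King1986] §4 p.670 l.8–13 «the operator defined by (2.13) with free boundary conditions») let `kingBoxHopping n c m²` be the datum with
bonds `(s,μ)` of weight `c` from `s` to `s+e_μ` WHEN `s_μ+1 < n_μ` (else a weight-`0` self-loop), site weights `m² + c·(#{μ : s_μ+1 < n_μ} + #{μ : 0 < s_μ})`.  Then:
* §1 box kinematics: `boxSucc_ne_self'`, `boxPred_boxSucc'`, `boxSucc_boxPred'`, `boxSucc_eq_iff` (`s′+e_μ = s ⟺ 0 < s_μ ∧ s′ = s−e_μ`);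
* §2 `kingBoxHopping`, ★ `kingBoxHopping_rowSum` (`= c·(#fwd + #bwd)`), `kingBoxHopping_neumann` (`c_s = m² + rowSum_s`), `kingBoxHopping_w_nonneg`, ★★ **`weightMatrix_kingBoxHopping`**,
  ★★★ **`scalarCoupling_kingBoxHopping`** (`= boxOp n c m²` — the scalar shadow of the covariant free-boundary operator IS King's Neumann box operator);
* §3 ★★★ **`norm_boxCoupling_inv_entry_le_kingBoxGreen`** — for every unitary link field `U` on the box bonds (`c ≥ 0`, `m² > 0`):
  `|((kingBoxHopping.coupling U)⁻¹)((s,i),(t,j))| ≤ (boxOp n c m²)⁻¹(s,t) = kingBoxGreen n c m² s t` (Ͱ-m on the box datum + Ν-a′ `boxOp_inv_eq_kingBoxGreen`), ★★ **`norm_boxCoupling_inv_entry_le_exp`**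
  (with Ε-d's box decay `boxOp_inv_le_exp`: `≤ 2^{d+1}(2∕m²)·periodConst κ_F d·e^{−(κ_F∕(d+1))·d_{T(2n)}(s̃,t̃)}` at every `U`), ★★ `norm_gfib_boxCoupling_inv_mulVec_le_div_mass` (`ℓ^∞` bound `≤ sup‖f‖∕m²`).
  Row s3's «torus-vs-box twin» at a LIVE link field: the torus (Ͱ-b) and the box (here) covariant fine covariances are both dominated by King's own `A = 0` kernels, with the same constants.

PRIOR TREE ART (by name): Ͱ-m (`scalarCoupling`, `norm_coupling_inv_entry_le`, `norm_gfib_coupling_inv_mulVec_le_div_mass`, `gfib`), Ν-a∕a′ (`KingBox`, `boxSucc`, `boxPred`, `boxOp`, `kingBoxGreen`,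
`boxOp_inv_eq_kingBoxGreen`), Ν-h (`boxSucc_apply_same∕_ne`, `boxPred_apply_same∕_ne`), Ε-d (`boxOp_inv_le_exp`), `LatticeDiamagneticInequality.Hopping`.  Dedup (rg at filing): basename 0 files;
needles `kingBoxHopping|scalarCoupling_kingBoxHopping|norm_boxCoupling_inv_entry_le_kingBoxGreen|boxSucc_eq_iff` 0 tree files.  Locators: [King1986] §4 p.670 l.8–13, (2.13) p.653, (4.4) p.670;
[Balaban1983RegularityDecay] (2.42) p.584; [Balaban1985BackgroundPropagators] (3.23)∕(3.24) p.394; [DodziukMathai2006] §1 Thm 1.5.  0 `sorry`, 1 `def`.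
-/

noncomputable section

open scoped BigOperators ComplexConjugate ComplexOrder
open Finset Matrix WithLp

namespace Summit.QuantumFields.YangMills.BalabanUVNodes.N15KingModelRung.Covariant

open Literature.MathematicalPhysics.QuantumFieldTheory.LatticeDiamagneticInequality (Hopping blk)
open Literature.MathematicalPhysics.QuantumFieldTheory.Balaban1983to89.B5Prop11Plancherel (Tor)
open Literature.MathematicalPhysics.QuantumFieldTheory.Balaban1983to89.B4TorusKernel (periodConst)
open Literature.MathematicalPhysics.QuantumFieldTheory.King1986.Torus (lapF tdistT)
open Summit.QuantumFields.YangMills.BalabanUVNodes.N15KingModelRung.TorusSpectral (KingBox boxSucc boxPred boxOp kingBoxGreen dblPer dblBox boxOp_inv_eq_kingBoxGreen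
  boxSucc_apply_same boxSucc_apply_ne boxPred_apply_same boxPred_apply_ne boxOp_inv_le_exp kappaFree)

variable {d : ℕ} (n : Fin (d + 1) → ℕ)

/-! ## §1 Box kinematics: successor and predecessor are inverse -/

/-- `s + e_μ ≠ s`. [folklore] -/
theorem boxSucc_ne_self' (s : KingBox n) (μ : Fin (d + 1)) (h : (s μ).val + 1 < n μ) : boxSucc n s μ h ≠ s := fun e => by
  have := congrArg (fun u : KingBox n => (u μ).val) e
  simp only [boxSucc_apply_same] at this
  omega

/-- `(s + e_μ) − e_μ = s`. [folklore] -/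
theorem boxPred_boxSucc' (s : KingBox n) (μ : Fin (d + 1)) (h : (s μ).val + 1 < n μ) (h' : 0 < (boxSucc n s μ h μ).val) :
    boxPred n (boxSucc n s μ h) μ h' = s := by
  funext ν
  by_cases hν : ν = μ
  · subst hν
    rw [boxPred_apply_same]
    apply Fin.ext
    simp only [boxSucc_apply_same, Nat.add_sub_cancel]
  · rw [boxPred_apply_ne n _ μ h' hν, boxSucc_apply_ne n s μ h hν]

/-- `(s − e_μ) + e_μ = s`. [folklore] -/
theorem boxSucc_boxPred' (s : KingBox n) (μ : Fin (d + 1)) (h : 0 < (s μ).val) (h' : (boxPred n s μ h μ).val + 1 < n μ) :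
    boxSucc n (boxPred n s μ h) μ h' = s := by
  funext ν
  by_cases hν : ν = μ
  · subst hν
    rw [boxSucc_apply_same]
    apply Fin.ext
    simp only [boxPred_apply_same]
    omega
  · rw [boxSucc_apply_ne n _ μ h' hν, boxPred_apply_ne n s μ h hν]

/-- The predecessor's successor exists: `(s−e_μ)_μ + 1 < n_μ`. [folklore] -/
theorem val_boxPred_succ_lt (s : KingBox n) (μ : Fin (d + 1)) (h : 0 < (s μ).val) : (boxPred n s μ h μ).val + 1 < n μ := by
  rw [boxPred_apply_same]
  have := (s μ).isLt
  simp only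
  omega

/-- ★ `s′ + e_μ = s` iff `0 < s_μ` and `s′ = s − e_μ`. [folklore] -/
theorem boxSucc_eq_iff (s s' : KingBox n) (μ : Fin (d + 1)) (h : (s' μ).val + 1 < n μ) :
    boxSucc n s' μ h = s ↔ ∃ h0 : 0 < (s μ).val, s' = boxPred n s μ h0 := by
  constructor
  · intro e
    subst e
    exact ⟨by rw [boxSucc_apply_same]; exact Nat.succ_pos _, (boxPred_boxSucc' n s' μ h _).symm⟩
  · rintro ⟨h0, rfl⟩
    exact boxSucc_boxPred' n s μ h0 _

/-! ## §2 The box hopping datum and its scalar shadow `boxOp` -/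

/-- THE BOX HOPPING DATUM of King's region `Ω` with free boundary conditions: bonds `(s, μ)` from `s` to `s+e_μ` of weight `c` when `s_μ + 1 < n_μ` (else a weight-`0` self-loop),
site weights `m² + c·(#{μ : s_μ+1 < n_μ} + #{μ : 0 < s_μ})`. [cite: King1986, §4 p.670 l.8–13, (2.13) p.653] -/
def kingBoxHopping (c m2 : ℝ) : Hopping (KingBox n) (KingBox n × Fin (d + 1)) where
  src := fun b => b.1
  tgt := fun b => if h : (b.1 b.2).val + 1 < n b.2 then boxSucc n b.1 b.2 h else b.1
  w := fun b => if (b.1 b.2).val + 1 < n b.2 then c else 0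
  c := fun s => m2 + c * ∑ μ : Fin (d + 1), ((if (s μ).val + 1 < n μ then (1 : ℝ) else 0) + (if 0 < (s μ).val then 1 else 0))

variable [hn : ∀ μ, NeZero (n μ)]

omit hn in
/-- The backward half of the row sum: `Σ_{s′}[tgt(s′,μ) = s]·w(s′,μ) = c·[0 < s_μ]`. [folklore] -/
theorem sum_tgt_eq (c m2 : ℝ) (s : KingBox n) (μ : Fin (d + 1)) :
    ∑ s' : KingBox n, (if (kingBoxHopping n c m2).tgt (s', μ) = s then (kingBoxHopping n c m2).w (s', μ) else 0) = if 0 < (s μ).val then c else 0 := by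
  by_cases h0 : 0 < (s μ).val
  · rw [if_pos h0, Finset.sum_eq_single (boxPred n s μ h0)]
    · simp only [kingBoxHopping, val_boxPred_succ_lt n s μ h0, dif_pos, if_true, boxSucc_boxPred']
    · intro s' _ hs'
      simp only [kingBoxHopping]
      by_cases h1 : (s' μ).val + 1 < n μ
      · rw [dif_pos h1, if_neg]
        intro h2
        obtain ⟨_, e⟩ := (boxSucc_eq_iff n s s' μ h1).mp h2
        exact hs' e
      · rw [dif_neg h1, if_neg h1]
        split_ifs <;> rfl
    · exact fun h => absurd (Finset.mem_univ _) h
  · rw [if_neg h0]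
    refine Finset.sum_eq_zero fun s' _ => ?_
    simp only [kingBoxHopping]
    by_cases h1 : (s' μ).val + 1 < n μ
    · rw [dif_pos h1, if_neg]
      intro h2
      obtain ⟨h0', _⟩ := (boxSucc_eq_iff n s s' μ h1).mp h2
      exact h0 h0'
    · rw [dif_neg h1, if_neg h1]
      split_ifs <;> rfl

/-- ★ THE ROW SUMS of the box datum: `rowSum_s = c·(#{μ : s_μ+1 < n_μ} + #{μ : 0 < s_μ})`. [cite: King1986, (2.13) p.653] -/
theorem kingBoxHopping_rowSum (c m2 : ℝ) (s : KingBox n) :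
    (kingBoxHopping n c m2).rowSum s = c * ∑ μ : Fin (d + 1), ((if (s μ).val + 1 < n μ then (1 : ℝ) else 0) + (if 0 < (s μ).val then 1 else 0)) := by
  rw [Hopping.rowSum, Finset.sum_add_distrib, Fintype.sum_prod_type, Fintype.sum_prod_type, Finset.sum_comm,
    Finset.sum_comm (f := fun s' μ => if (kingBoxHopping n c m2).tgt (s', μ) = s then (kingBoxHopping n c m2).w (s', μ) else 0), ← Finset.sum_add_distrib, Finset.mul_sum]
  refine Finset.sum_congr rfl fun μ _ => ?_
  rw [sum_tgt_eq, mul_add]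
  congr 1
  · have : ∀ s' : KingBox n, (if (kingBoxHopping n c m2).src (s', μ) = s then (kingBoxHopping n c m2).w (s', μ) else 0) = if s' = s then (if (s μ).val + 1 < n μ then c else 0) else 0 := by
      intro s'
      by_cases h : s' = s
      · subst h; simp [kingBoxHopping]
      · simp [kingBoxHopping, h]
    simp only [this, Finset.sum_ite_eq' Finset.univ s, Finset.mem_univ, if_true]
    split_ifs <;> simp
  · split_ifs <;> simp

/-- The free-boundary convention holds: `c_s = m² + rowSum_s`. [cite: King1986, §4 p.670 l.8–13] -/
theorem kingBoxHopping_neumann (c m2 : ℝ) (s : KingBox n) : (kingBoxHopping n c m2).c s = m2 + (kingBoxHopping n c m2).rowSum s := by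
  rw [kingBoxHopping_rowSum]; rfl

omit hn in
/-- The bond weights are non-negative (`c ≥ 0`). [folklore] -/
theorem kingBoxHopping_w_nonneg {c : ℝ} (hc : 0 ≤ c) (m2 : ℝ) (b : KingBox n × Fin (d + 1)) : 0 ≤ (kingBoxHopping n c m2).w b := by
  simp only [kingBoxHopping]; split_ifs <;> simp [hc]

/-- ★★ THE WEIGHT MATRIX of the box datum: `t(s,t) = c·Σ_μ([s_μ+1<n_μ][t = s+e_μ] + [t_μ+1<n_μ][s = t+e_μ])`. [cite: King1986, (2.13) p.653] -/
theorem weightMatrix_kingBoxHopping (c m2 : ℝ) (s t : KingBox n) :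
    (kingBoxHopping n c m2).weightMatrix s t
      = c * ∑ μ : Fin (d + 1), ((if h : (s μ).val + 1 < n μ then (if t = boxSucc n s μ h then (1 : ℝ) else 0) else 0)
          + (if h : (t μ).val + 1 < n μ then (if s = boxSucc n t μ h then (1 : ℝ) else 0) else 0)) := by
  simp only [Hopping.weightMatrix, Matrix.of_apply]
  rw [Fintype.sum_prod_type, Finset.sum_comm, Finset.mul_sum]
  refine Finset.sum_congr rfl fun μ _ => ?_
  rw [Finset.sum_add_distrib, mul_add]
  congr 1
  · rw [Finset.sum_eq_single s (fun s' _ hs' => by simp [kingBoxHopping, hs']) (fun h => absurd (Finset.mem_univ _) h)]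
    simp only [kingBoxHopping, true_and]
    by_cases h : (s μ).val + 1 < n μ
    · simp only [h, dif_pos, if_true, eq_comm]
      split_ifs <;> simp
    · simp [h]
  · rw [Finset.sum_eq_single t (fun s' _ hs' => by simp [kingBoxHopping, hs']) (fun h => absurd (Finset.mem_univ _) h)]
    simp only [kingBoxHopping, and_true]
    by_cases h : (t μ).val + 1 < n μ
    · simp only [h, dif_pos, if_true, eq_comm]
      split_ifs <;> simp
    · simp [h]

/-- ★★★ **THE SCALAR SHADOW OF THE COVARIANT FREE-BOUNDARY OPERATOR IS KING's NEUMANN BOX OPERATOR**: `scalarCoupling (kingBoxHopping n c m²) = boxOp n c m²`.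
[cite: King1986, §4 p.670 l.8–13, (2.13) p.653; Balaban1983RegularityDecay, (2.42) p.584] -/
theorem scalarCoupling_kingBoxHopping (c m2 : ℝ) : scalarCoupling (kingBoxHopping n c m2) = boxOp n c m2 := by
  ext s t
  rw [scalarCoupling, Matrix.sub_apply, diagonal_apply, weightMatrix_kingBoxHopping]
  simp only [boxOp, kingBoxHopping]
  by_cases hst : s = t
  · subst hst
    simp only [if_true]
    have h1 : ∀ μ (h : (s μ).val + 1 < n μ), ¬ (s = boxSucc n s μ h) := fun μ h e => boxSucc_ne_self' n s μ h e.symm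
    have h2 : ∀ μ (h : 0 < (s μ).val), ¬ (s = boxPred n s μ h) := fun μ h e => by
      have := congrArg (fun u : KingBox n => (u μ).val) e
      simp only [boxPred_apply_same] at this
      omega
    rw [mul_one, add_sub_assoc, ← mul_sub, ← Finset.sum_sub_distrib]
    congr 1
    congr 1
    refine Finset.sum_congr rfl fun μ _ => ?_
    by_cases ha : (s μ).val + 1 < n μ <;> by_cases hb : 0 < (s μ).val <;> simp [ha, hb, h1, h2]
  · rw [if_neg hst, zero_sub, if_neg (Ne.symm hst), mul_zero, zero_add, ← mul_neg, ← Finset.sum_neg_distrib]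
    congr 1
    refine Finset.sum_congr rfl fun μ _ => ?_
    rw [neg_add]
    congr 1
    · by_cases ha : (s μ).val + 1 < n μ
      · simp only [ha, dif_pos, zero_sub]
      · simp [ha]
    · by_cases hb : 0 < (s μ).val
      · rw [dif_pos hb, zero_sub]
        by_cases ht : (t μ).val + 1 < n μ
        · rw [dif_pos ht]
          congr 1
          refine if_congr ?_ rfl rfl
          rw [eq_comm, boxSucc_eq_iff]
          exact ⟨fun ⟨_, e⟩ => e, fun e => ⟨hb, e⟩⟩
        · rw [dif_neg ht, if_neg, neg_zero]
          intro e
          have := congrArg (fun u : KingBox n => (u μ).val) e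
          simp only [boxPred_apply_same] at this
          omega
      · rw [dif_neg hb]
        by_cases ht : (t μ).val + 1 < n μ
        · rw [dif_pos ht, if_neg, neg_zero]
          intro e
          obtain ⟨h0', _⟩ := (boxSucc_eq_iff n s t μ ht).mp e.symm
          exact hb h0'
        · rw [dif_neg ht, neg_zero]

/-! ## §3 Domination on the box at every link field -/

variable {𝕜 : Type*} [RCLike 𝕜] {ν : Type*} [Fintype ν] [DecidableEq ν]

/-- ★★★ **THE BOX TWIN AT A LIVE LINK FIELD**: for every unitary link field `U` on the bonds of King's region `Ω` (`c ≥ 0`, `m² > 0`), the covariant free-boundary fine covariance is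
dominated ENTRYWISE by King's `A = 0` Neumann box covariance: `|((kingBoxHopping.coupling U)⁻¹)((s,i),(t,j))| ≤ (boxOp n c m²)⁻¹(s,t) = kingBoxGreen n c m² s t`.
[cite: King1986, §4 p.670 l.8–13; Balaban1983RegularityDecay, (2.42) p.584; DodziukMathai2006, Thm 1.5 §1] -/
theorem norm_boxCoupling_inv_entry_le_kingBoxGreen {c m2 : ℝ} (hc : 0 ≤ c) (hm : 0 < m2) {U : KingBox n × Fin (d + 1) → Matrix ν ν 𝕜}
    (hU : ∀ b, U b ∈ Matrix.unitaryGroup ν 𝕜) (s t : KingBox n) (i j : ν) :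
    ‖((kingBoxHopping n c m2).coupling U)⁻¹ (s, i) (t, j)‖ ≤ kingBoxGreen n c m2 s t := by
  rw [← boxOp_inv_eq_kingBoxGreen n hc hm, ← scalarCoupling_kingBoxHopping]
  exact norm_coupling_inv_entry_le (kingBoxHopping n c m2) (kingBoxHopping_w_nonneg n hc m2) (kingBoxHopping_neumann n c m2) hm hU s t i j

/-- ★★ **… WITH THE BOX DECAY**: `|((kingBoxHopping.coupling U)⁻¹)((s,i),(t,j))| ≤ 2^{d+1}·(2∕m²)·periodConst κ_F d·e^{−(κ_F∕(d+1))·d_{T(2n)}(s̃,t̃)}` at every unitary `U` (Ε-d `boxOp_inv_le_exp`).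
[cite: King1986, §4 p.670 l.8–13, (4.4) p.670; Balaban1984PropagatorsI, p.38 (1.126)] -/
theorem norm_boxCoupling_inv_entry_le_exp {c m2 : ℝ} (hc : 0 ≤ c) (hm : 0 < m2) {U : KingBox n × Fin (d + 1) → Matrix ν ν 𝕜}
    (hU : ∀ b, U b ∈ Matrix.unitaryGroup ν 𝕜) (s t : KingBox n) (i j : ν) :
    ‖((kingBoxHopping n c m2).coupling U)⁻¹ (s, i) (t, j)‖
      ≤ 2 ^ (d + 1) * (2 / m2 * periodConst (kappaFree c m2 d) d * Real.exp (-(kappaFree c m2 d / (d + 1) * tdistT (dblPer n) (dblBox n s) (dblBox n t)))) := by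
  refine (norm_boxCoupling_inv_entry_le_kingBoxGreen n hc hm hU s t i j).trans ?_
  rw [← boxOp_inv_eq_kingBoxGreen n hc hm]
  exact (boxOp_inv_le_exp n hc hm s t).2

/-- ★★ **THE `ℓ^∞` BOUND ON THE BOX**: `‖((covariant box operator)⁻¹f)_s‖ ≤ sup‖f‖∕m²` at every unitary `U`. [cite: DodziukMathai2006, Lemma 1.1 §1; Balaban1985BackgroundPropagators, (3.39) p.397] -/
theorem norm_gfib_boxCoupling_inv_mulVec_le_div_mass {c m2 : ℝ} (hc : 0 ≤ c) (hm : 0 < m2) {U : KingBox n × Fin (d + 1) → Matrix ν ν 𝕜}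
    (hU : ∀ b, U b ∈ Matrix.unitaryGroup ν 𝕜) {f : KingBox n × ν → 𝕜} {F : ℝ} (hF : ∀ t, ‖gfib f t‖ ≤ F) (s : KingBox n) :
    ‖gfib (((kingBoxHopping n c m2).coupling U)⁻¹ *ᵥ f) s‖ ≤ F / m2 :=
  norm_gfib_coupling_inv_mulVec_le_div_mass (kingBoxHopping n c m2) (kingBoxHopping_w_nonneg n hc m2) (kingBoxHopping_neumann n c m2) hm hU hF s

end Summit.QuantumFields.YangMills.BalabanUVNodes.N15KingModelRung.Covariant

end
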